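import Literature.NumberTheory.GelbartRogawski1991.CMThetaTypeVocabulary                -- ★ the shared vocabulary: `xThetaCM`, `IsoAtXfCM`, `ThetaTypeAtCM`
import Summits.HodgeConjecture.HodgeConjecture.Theorems.F0P2cStubCLLocalTypeExists      -- ★ F0P2-p03 (g2): `stubCL_holds` (Flath purification: local types exist)
import Summits.HodgeConjecture.HodgeConjecture.Theorems.F0P2hLTYLocalConstituents       -- ★ F0P2-p01 (g5): `isConstituentOf_type_of_isotypicComponent_eq_top`, `exists_comap_isConstituentOf_and_type`
import HarnessLib

/-!
# FLOOR-0 P2 — ROW «ISO-BRIDGE (β)»: the CLASS → REPRESENTATION bridge `ThetaTypeAtCM … v c ⟹ IsoAtXfCM … σ … v` for the local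
# constituent class `c` of an irreducible admissible `σ` of `U(H)(𝔸_{L⁺,f})` (in-house, S)

Cell hodgecm-mathlib (D-0151), FLOOR 0, programme P2 (theta ∕ `hdictE`); crux item H413 = stmt-HodgeConjecture-24833 (`HCCMUnconditional.H413`);
F0P2-plan (g8) ROW «ISO-BRIDGE (β)» 2026-08-31T17:36:56Z (B-p14 (g27) census `CENSUS-D7alpha-MEM` 19166c0af0763e8a (iv)(β)): the class-level theta-type
predicate of the (N)∕(S)-dictionary and of the docking clauses (★ `GelbartRogawski1991.ThetaTypeAtCM`, `CMThetaTypeVocabulary` :148) must be turned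
into the representation-level isotypy that `StubRIGf` ∕ D7α conclude (★ `GelbartRogawski1991.IsoAtXfCM`, :126) — for tomorrow's PKΠ «D7α SPLIT» glue.
Seat A-p12 (g17).  THEOREMS ONLY (no `def`, no instance, no notation, no named fact, no `sorry`); never imports a `Cruxes/…/Lines` module;
`--supports stmt-HodgeConjecture-24833 --as helper`.  HC_CM is proved only modulo the printed citations until rung 0 closes; this file discharges
none of them — it is kernel glue between two ★ vocabularies.

THE TWO BODIES.  `IsoAtXfCM … σ μ hμ χf ε v := isotypicComponent ℂ[U(H)(L⁺_v)] (σ ∘ inclPlace v) (X_v(μ,ε,χf) ∘ κ_v⁻¹) = ⊤` and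
`ThetaTypeAtCM … μ hμ χf ε v c := ∀ (T : Type) τ irreducible, comap (localPiEquiv v) c a constituent of τ → ∀ (W' : Type) ρ', ρ' τ-isotypic →
ρ' (X_v ∘ κ_v⁻¹)-isotypic` share the right-hand isotypy clause; the bridge is the single instantiation `ρ' := σ ∘ inclPlace v`, `τ :=` a local type of
`σ` at `v`, and needs exactly
(a) **⊗′-ISOTYPY** «`σ ∘ inclPlace v` is `τ`-isotypic for some irreducible `τ` on a `T : Type`» = ★ `F0P2cStubCLLocalTypeExists.stubCL_holds` (Flath's
    purification ★ `exists_purified_at` + brick (iv); no Gelfand pair, no `HasFinComponent`) [FlathCorvallis1979, Thm. 2, §2 Ex. 2; Bump1997, Prop. 3.4.1];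
(b) «a constituent class of the `τ`-isotypic `σ ∘ inclPlace v` is a constituent class of `τ`» = ★ `F0P2hLTYLocalConstituents.isConstituentOf_type_of_isotypicComponent_eq_top`
    (★ Σ♭ `IrrClass.IsConstituentOf.of_isotypicComponent_eq_top_comp` at `e = id`) [BourbakiAlgebreVIII2012, VIII §4 n°2].

* §1 (generic frame `F E c N J`, any target module `X`) **`isotypicComponent_comp_inclPlace_eq_top_of_classLevel`** — for `σ` irreducible admissible of
  `U(J)(𝔸_{F,f})`, a finite `v`, a `ℂ[U(J)(F_v)]`-module `X`, and a constituent class `c₀` of `σ ∘ inclPlace v` carrying the CLASS-LEVEL clause «every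
  irreducible `τ : Type` of which `c₀` is a constituent makes every `τ`-isotypic `ρ' : Type` `X`-isotypic», `σ ∘ inclPlace v` is `X`-isotypic; and
  **`isotypicComponent_comp_inclPlace_eq_top_of_forall_constituent`** — the same with the clause assumed for EVERY constituent class (a constituent exists:
  ★ `F0P3FinRepConstituentsExist.exists_isConstituentOf_comp_inclPlace`).
* §2 (CM, `N = 3`, the vocabulary's binders verbatim) **`isoAtXfCM_of_thetaTypeAtCM`** — `σ` irreducible admissible, `c : IrrClass ((cmDatum L 3 H).Local v)` with
  `IrrClass.comap (localPiEquiv … v) c` a constituent of `σ ∘ inclPlace v` (the antecedent of D6 ★ `LocalConstituentsIn`, VERBATIM) and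
  `ThetaTypeAtCM … μ hμ χf ε v c` ⟹ `IsoAtXfCM … σ μ hμ χf ε v`; **`exists_isoAtXfCM_of_forall_constituent`** — if EVERY such constituent class is a theta
  type for SOME line class `ε`, then `∃ ε, IsoAtXfCM … σ μ hμ χf ε v` (the conclusion shape of `StubRIGf`, read through ★ `F0P2iVocabularyBridge.isoAtXf_iff_CM`,
  `Iff.rfl`); **`exists_constituent_comp_inclPlace_CM`** — a constituent class in that currency exists.

## References
* [FlathCorvallis1979] D. Flath, *Decomposition of representations into tensor products*, PSPM 33.1 (1979): Thm. 2, Thm. 3, §2 Example 2.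
* [Bump1997] D. Bump, *Automorphic Forms and Representations* (1997): §3.4 Prop. 3.4.1, Thm. 3.4.4.
* [BourbakiAlgebreVIII2012] N. Bourbaki, *Algèbre VIII* (2012): §4 n°2 (isotypic components).
* [GelbartRogawski1991] S. Gelbart, J. Rogawski, Invent. Math. 105 (1991): §5.1 (5.1.1), Lemma 5.1.2 p. 466.
* [Liu2021] Y. Liu, Camb. J. Math. 9 (2021) = arXiv:2102.11518: Def. 4.11 (l. 2090–2096).
-/

set_option autoImplicit false
-- the mandated namespace has the single-problem summit's repeated segment (`HodgeConjecture.HodgeConjecture`)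
set_option linter.dupNamespace false

noncomputable section

open scoped MonoidAlgebra Matrix
open NumberField IsDedekindDomain

namespace Summit.HodgeConjecture.HodgeConjecture.Cruxes.H413.F0P2oIsoAtXfOfThetaTypeAt

open Literature.NumberTheory.Automorphic Literature.NumberTheory.Automorphic.UnitaryGroup
open Literature.NumberTheory.Automorphic.IdeleClassGroup
open Literature.NumberTheory.Rogawski1990 Literature.NumberTheory.GelbartRogawski1991
open Literature.RepresentationTheory.Liu2021
open Summit.HodgeConjecture.HodgeConjecture.Cruxes.H413.F0P2cStubCLLocalTypeExists
open Summit.HodgeConjecture.HodgeConjecture.Cruxes.H413.F0P2hLTYLocalConstituents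
open Summit.HodgeConjecture.HodgeConjecture.Cruxes.H413.F0P3FinRepConstituentsExist

/-! ## §1 Generic frame `F E c N J`: class-level isotypy clause ⟹ isotypy of `σ ∘ inclPlace v` -/

section GenericFrame

variable {F E : Type} [Field F] [NumberField F] [Field E] [NumberField E] [Algebra F E] {c : E ≃ₐ[F] E} {N : ℕ}
  {J : Matrix (Fin N) (Fin N) E}

/-- **CLASS LEVEL ⟹ REPRESENTATION LEVEL, at a given constituent.**  Let `σ` be an irreducible admissible representation of `U(J)(𝔸_{F,f})` on
`W : Type`, `v` a finite place, `X` a `ℂ[U(J)(F_v)]`-module, and `c₀` a constituent class of `σ ∘ inclPlace v` such that for every irreducible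
`τ` (on a `T : Type`) of which `c₀` is a constituent, every `τ`-isotypic `ρ'` (on a `W' : Type`) is `X`-isotypic.  Then `σ ∘ inclPlace v` is
`X`-isotypic: by ★ `stubCL_holds` there is an irreducible `τ : Type` with `σ ∘ inclPlace v` `τ`-isotypic (Flath), `c₀` is a constituent of that `τ`
(★ `isConstituentOf_type_of_isotypicComponent_eq_top`), and the clause applies to `ρ' := σ ∘ inclPlace v`.
[cite: FlathCorvallis1979, Thm. 2 and §2 Example 2] [cite: Bump1997, §3.4 Prop. 3.4.1] [cite: BourbakiAlgebreVIII2012, VIII §4 n°2] -/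
theorem isotypicComponent_comp_inclPlace_eq_top_of_classLevel {W : Type} [AddCommGroup W] [Module ℂ W]
    {σ : Representation ℂ (finAdelic F E c N J) W} (hirr : σ.IsIrreducible) (hadm : σ.IsAdmissible) (v : HeightOneSpectrum (𝓞 F))
    (X : Type*) [AddCommGroup X] [Module (MonoidAlgebra ℂ (localPi E c N J v)) X]
    {c₀ : IrrClass ↥(localPi E c N J v)} (hc₀ : c₀.IsConstituentOf (σ.comp (inclPlace F E c N J v)))
    (hcl : ∀ (T : Type) [AddCommGroup T] [Module ℂ T] (τ : Representation ℂ ↥(localPi E c N J v) T), τ.IsIrreducible →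
      c₀.IsConstituentOf τ →
      ∀ (W' : Type) [AddCommGroup W'] [Module ℂ W'] (ρ' : Representation ℂ ↥(localPi E c N J v) W'),
        isotypicComponent (MonoidAlgebra ℂ (localPi E c N J v)) (Representation.asModule ρ') (Representation.asModule τ) = ⊤ →
        isotypicComponent (MonoidAlgebra ℂ (localPi E c N J v)) (Representation.asModule ρ') X = ⊤) :
    isotypicComponent (MonoidAlgebra ℂ (localPi E c N J v)) (Representation.asModule (σ.comp (inclPlace F E c N J v))) X = ⊤ := by
  obtain ⟨T, _, _, τ, hτ, htop⟩ := stubCL_holds F E c N J W σ hirr hadm v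
  haveI := hτ
  exact hcl T τ hτ (isConstituentOf_type_of_isotypicComponent_eq_top htop hc₀) W (σ.comp (inclPlace F E c N J v)) htop

/-- **CLASS LEVEL ⟹ REPRESENTATION LEVEL, over all constituents.**  As `isotypicComponent_comp_inclPlace_eq_top_of_classLevel`, with the class-level
clause assumed for EVERY constituent class of `σ ∘ inclPlace v` (one exists for an irreducible smooth `σ`: ★ `exists_isConstituentOf_comp_inclPlace`).
[cite: FlathCorvallis1979, Thm. 2 and §2 Example 2] [cite: BourbakiAlgebreVIII2012, VIII §4 n°2] -/
theorem isotypicComponent_comp_inclPlace_eq_top_of_forall_constituent {W : Type} [AddCommGroup W] [Module ℂ W]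
    {σ : Representation ℂ (finAdelic F E c N J) W} (hirr : σ.IsIrreducible) (hadm : σ.IsAdmissible) (v : HeightOneSpectrum (𝓞 F))
    (X : Type*) [AddCommGroup X] [Module (MonoidAlgebra ℂ (localPi E c N J v)) X]
    (hcl : ∀ c₀ : IrrClass ↥(localPi E c N J v), c₀.IsConstituentOf (σ.comp (inclPlace F E c N J v)) →
      ∀ (T : Type) [AddCommGroup T] [Module ℂ T] (τ : Representation ℂ ↥(localPi E c N J v) T), τ.IsIrreducible →
      c₀.IsConstituentOf τ →
      ∀ (W' : Type) [AddCommGroup W'] [Module ℂ W'] (ρ' : Representation ℂ ↥(localPi E c N J v) W'),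
        isotypicComponent (MonoidAlgebra ℂ (localPi E c N J v)) (Representation.asModule ρ') (Representation.asModule τ) = ⊤ →
        isotypicComponent (MonoidAlgebra ℂ (localPi E c N J v)) (Representation.asModule ρ') X = ⊤) :
    isotypicComponent (MonoidAlgebra ℂ (localPi E c N J v)) (Representation.asModule (σ.comp (inclPlace F E c N J v))) X = ⊤ := by
  obtain ⟨c₀, hc₀⟩ := exists_isConstituentOf_comp_inclPlace hirr hadm.1 v
  exact isotypicComponent_comp_inclPlace_eq_top_of_classLevel hirr hadm v X hc₀ (hcl c₀ hc₀)

end GenericFrame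

/-! ## §2 CM, `N = 3`: `ThetaTypeAtCM … v c ⟹ IsoAtXfCM … σ … v` -/

section CM

variable (L : Type) [Field L] [NumberField L] [IsCMField L] (H : Matrix (Fin 3) (Fin 3) L) {n' : ℕ} (e₁ : Fin 3 × Fin 1 ≃ Fin n') (dV : Fin 3 → L)
  (hdV : ∀ i, IsCMField.complexConj L (dV i) = dV i) (hdV0 : ∀ i, dV i ≠ 0) (g : GL (Fin 3) L)
  (hg : ((g : Matrix (Fin 3) (Fin 3) L).map (cmConjRingHom L))ᵀ * H * (g : Matrix (Fin 3) (Fin 3) L) = Matrix.diagonal dV)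
  {W : Type} [AddCommGroup W] [Module ℂ W] (σ : Representation ℂ (finAdelic (↥(maximalRealSubfield L)) L (IsCMField.complexConj L) 3 H) W)
  (μ : Literature.NumberTheory.Automorphic.IdeleClassGroup L →ₜ* Circle) (hμ : IsConjugateSymplectic L μ)
  (χf : UnitaryGroup.finAdelicOne (↥(maximalRealSubfield L)) L (IsCMField.complexConj L) →* ℂˣ)

/-- **A CONSTITUENT CLASS OF `σ_v` EXISTS, in D6 currency**: for `σ` irreducible smooth of `U(H)(𝔸_{L⁺,f})` and a finite `v`, some class
`c : IrrClass ((cmDatum L 3 H).Local v)` has `IrrClass.comap (localPiEquiv … v) c` a constituent of `σ ∘ inclPlace v` (★ `exists_isConstituentOf_comp_inclPlace`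
read through ★ `IrrClass.comap_comap_symm`). [cite: BushnellHenniart2006, §1.1, §2] [cite: FlathCorvallis1979, Thm. 3] -/
theorem exists_constituent_comp_inclPlace_CM (hirr : σ.IsIrreducible) (hsm : σ.IsSmooth) (v : HeightOneSpectrum (𝓞 ↥(maximalRealSubfield L))) :
    ∃ c : IrrClass ((cmDatum L 3 H).Local v),
      (IrrClass.comap (localPiEquiv L (IsCMField.complexConj L) 3 H v) c).IsConstituentOf
        (σ.comp (inclPlace (↥(maximalRealSubfield L)) L (IsCMField.complexConj L) 3 H v)) := by
  obtain ⟨c₀, hc₀⟩ := exists_isConstituentOf_comp_inclPlace hirr hsm v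
  -- in `«local»` currency (`(cmDatum L 3 H).Local v` is `↥(«local» … v)` by `rfl`, but only `exact` sees through it)
  have h : (IrrClass.comap (localPiEquiv L (IsCMField.complexConj L) 3 H v)
      (IrrClass.comap (localPiEquiv L (IsCMField.complexConj L) 3 H v).symm c₀)).IsConstituentOf
        (σ.comp (inclPlace (↥(maximalRealSubfield L)) L (IsCMField.complexConj L) 3 H v)) := by
    rwa [IrrClass.comap_comap_symm]
  exact ⟨_, h⟩

/-- **ROW «ISO-BRIDGE (β)» — `ThetaTypeAtCM ⟹ IsoAtXfCM` at the local constituent.**  For `σ` an irreducible admissible representation of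
`U(H)(𝔸_{L⁺,f})` on `W : Type`, a finite place `v`, a class `c : IrrClass ((cmDatum L 3 H).Local v)` whose pull-back along ★ `localPiEquiv … v` is a
constituent of `σ ∘ inclPlace v` (the antecedent of D6 ★ `LocalConstituentsIn`, verbatim), and `ThetaTypeAtCM … μ hμ χf ε v c` («`c` IS the theta type
`X_v(μ,ε,χf) ∘ κ_v⁻¹`»): `σ ∘ inclPlace v` is `X_v(μ,ε,χf) ∘ κ_v⁻¹`-isotypic, i.e. `IsoAtXfCM … σ μ hμ χf ε v`.  Proof: §1 at `X := (X_v ∘ κ_v⁻¹).asModule`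
— the ⊗′-isotypy of `σ|_{U(H)(L⁺_v)}` (★ `stubCL_holds`, Flath) and «constituents of an isotypic representation are its type».  `P.HasFinComponent σ`
is not needed. [cite: FlathCorvallis1979, Thm. 2 and §2 Example 2] [cite: Liu2021, Def. 4.11 (l. 2090–2096)] [cite: GelbartRogawski1991, §5.1 (5.1.1), Lem 5.1.2 p. 466] -/
theorem isoAtXfCM_of_thetaTypeAtCM (hirr : σ.IsIrreducible) (hadm : σ.IsAdmissible) (ε : (↥(maximalRealSubfield L))ˣ)
    (v : HeightOneSpectrum (𝓞 ↥(maximalRealSubfield L))) (c : IrrClass ((cmDatum L 3 H).Local v))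
    (hc : (IrrClass.comap (localPiEquiv L (IsCMField.complexConj L) 3 H v) c).IsConstituentOf
      (σ.comp (inclPlace (↥(maximalRealSubfield L)) L (IsCMField.complexConj L) 3 H v)))
    (hθ : ThetaTypeAtCM L H e₁ dV hdV hdV0 g hg μ hμ χf ε v c) :
    IsoAtXfCM L H e₁ dV hdV hdV0 g hg σ μ hμ χf ε v := by
  -- §1's three lines, re-run at the vocabulary's `X` (one delta-unfolding of each predicate, no higher-order unification)
  obtain ⟨T, _, _, τ, hτ, htop⟩ := stubCL_holds (↥(maximalRealSubfield L)) L (IsCMField.complexConj L) 3 H W σ hirr hadm v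
  haveI := hτ
  exact hθ T τ hτ (isConstituentOf_type_of_isotypicComponent_eq_top htop hc) W
    (σ.comp (inclPlace (↥(maximalRealSubfield L)) L (IsCMField.complexConj L) 3 H v)) htop

/-- **ROW «ISO-BRIDGE (β)», existential form — the shape `StubRIGf` ∕ D7α conclude.**  If EVERY constituent class `c` of `σ ∘ inclPlace v` (D6
currency) is a `(μ, χf)`-theta type of SOME line class `ε` (`∃ ε, ThetaTypeAtCM … μ hμ χf ε v c` — what the record packet's membership + the
(N)∕docking clauses deliver class by class), then `∃ ε, IsoAtXfCM … σ μ hμ χf ε v` (= `∃ ε, IsoAtXf … σ μ hμ χf ε v` of the sub-line by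
★ `F0P2iVocabularyBridge.isoAtXf_iff_CM`, `Iff.rfl`): a constituent class exists (`exists_constituent_comp_inclPlace_CM`), and `isoAtXfCM_of_thetaTypeAtCM`.
[cite: FlathCorvallis1979, Thm. 2 and §2 Example 2] [cite: GelbartRogawski1991, §5.1 (5.1.1), Lem 5.1.2 p. 466] -/
theorem exists_isoAtXfCM_of_forall_constituent (hirr : σ.IsIrreducible) (hadm : σ.IsAdmissible)
    (v : HeightOneSpectrum (𝓞 ↥(maximalRealSubfield L)))
    (hθ : ∀ c : IrrClass ((cmDatum L 3 H).Local v),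
      (IrrClass.comap (localPiEquiv L (IsCMField.complexConj L) 3 H v) c).IsConstituentOf
          (σ.comp (inclPlace (↥(maximalRealSubfield L)) L (IsCMField.complexConj L) 3 H v)) →
        ∃ ε : (↥(maximalRealSubfield L))ˣ, ThetaTypeAtCM L H e₁ dV hdV hdV0 g hg μ hμ χf ε v c) :
    ∃ ε : (↥(maximalRealSubfield L))ˣ, IsoAtXfCM L H e₁ dV hdV hdV0 g hg σ μ hμ χf ε v := by
  obtain ⟨c, hc⟩ := exists_constituent_comp_inclPlace_CM L H σ hirr hadm.1 v
  obtain ⟨ε, hε⟩ := hθ c hc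
  exact ⟨ε, isoAtXfCM_of_thetaTypeAtCM L H e₁ dV hdV hdV0 g hg σ μ hμ χf hirr hadm ε v c hc hε⟩

/-- **Membership form** (the road B-p14 (g27)'s census (iv) names): if every constituent class of `σ ∘ inclPlace v` lies in a set `M` of classes
(e.g. `M = (Pv v).members` from D6 ★ `LocalConstituentsIn` ∕ LTY) and every member of `M` is a `(μ, χf)`-theta type of some line class, then
`∃ ε, IsoAtXfCM … σ μ hμ χf ε v`. [cite: GelbartRogawski1991, §5.1 (5.1.1), Lem 5.1.2 p. 466] [cite: FlathCorvallis1979, Thm. 2 and §2 Example 2] -/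
theorem exists_isoAtXfCM_of_forall_mem (hirr : σ.IsIrreducible) (hadm : σ.IsAdmissible)
    (v : HeightOneSpectrum (𝓞 ↥(maximalRealSubfield L))) (M : Set (IrrClass ((cmDatum L 3 H).Local v)))
    (hM : ∀ c : IrrClass ((cmDatum L 3 H).Local v),
      (IrrClass.comap (localPiEquiv L (IsCMField.complexConj L) 3 H v) c).IsConstituentOf
          (σ.comp (inclPlace (↥(maximalRealSubfield L)) L (IsCMField.complexConj L) 3 H v)) → c ∈ M)
    (hθ : ∀ c ∈ M, ∃ ε : (↥(maximalRealSubfield L))ˣ, ThetaTypeAtCM L H e₁ dV hdV hdV0 g hg μ hμ χf ε v c) :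
    ∃ ε : (↥(maximalRealSubfield L))ˣ, IsoAtXfCM L H e₁ dV hdV hdV0 g hg σ μ hμ χf ε v :=
  exists_isoAtXfCM_of_forall_constituent L H e₁ dV hdV hdV0 g hg σ μ hμ χf hirr hadm v fun c hc => hθ c (hM c hc)

end CM

end Summit.HodgeConjecture.HodgeConjecture.Cruxes.H413.F0P2oIsoAtXfOfThetaTypeAt

end
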